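import Summits.Schanuel.Schanuel.Theorems.ZilberEacCylinderCriterion
import HarnessLib

/-!
# Arbitrary base branches, CVII: THE TRANSPOSE OF A TWO-VARIABLE POLYNOMIAL IN ROWS FORM — the
# complete verdict over `ℚ̄`-curves with a horizontal asymptote WITHOUT transpose hypotheses

HONEST FRAMING.  Cell `pub-schanuel` (Zilber's Exponential-Algebraic Closedness, case ladder;
host summit Schanuel), seat 2, gen 33.  Bookkeeping.  File CIV's complete verdict asked for the
transpose `Ft` of `F` together with its irreducibility and the algebraicity of its coefficients;
both follow from the same properties of `F`: **`exists_transposeRows`** (a transpose with the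
transposed coefficient array), **`irreducible_of_transposeRows`** (through `ℂ[x₀, x₁]` and the
swap of variables).  Hence **`unprojectedDense_of_mmCase_topRowRoot_algebraic'`**: for every
irreducible `F ∈ ℚ̄[x₀][x₁]` of `x₁`-degree `≥ 2` whose top row has a root, EVERY surface of
Mantova–Masser's case with base curve `{F = 0}` has Zariski-dense exponential points.  The
question stays OPEN in general (PLMS 2024 §1 p. 5); EC(3,2) OPEN; NOT Schanuel's conjecture
(neither used nor implied); EAC ⇏ SC.
-/

noncomputable section

open Filter Topology Set Complex Polynomial
open Literature.NumberTheory.Transcendental Literature.ModelTheory.Zilber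
open Literature.ModelTheory.ExponentialFields

set_option linter.dupNamespace false

namespace Summit.Schanuel.Schanuel.Theorems

section TransposeRows

variable (F : ℂ[X][X])

/-- **The transpose in rows form**: `Ft(x, y) = F(y, x)` with `(Ft)_{j,i} = F_{i,j}`. [folklore] -/
theorem exists_transposeRows : ∃ Ft : ℂ[X][X],
    (∀ x y : ℂ, (Ft.map (Polynomial.evalRingHom x)).eval y = (F.map (Polynomial.evalRingHom y)).eval x) ∧
    (∀ i j, (Ft.coeff j).coeff i = (F.coeff i).coeff j) := by
  classical
  -- `Ft = Σ_i (F_i with its variable made the outer one) · (C X)^i`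
  refine ⟨∑ i ∈ Finset.range (F.natDegree + 1),
    (F.coeff i).map (Polynomial.C : ℂ →+* ℂ[X]) * Polynomial.C (X ^ i), fun x y => ?_, fun i j => ?_⟩
  · rw [Polynomial.map_sum, Polynomial.eval_finsetSum,
      eval_map_eq_rowSum F (Polynomial.evalRingHom y) le_rfl]
    refine Finset.sum_congr rfl fun i _ => ?_
    have hid : (Polynomial.evalRingHom x).comp (Polynomial.C : ℂ →+* ℂ[X]) = RingHom.id ℂ := by
      ext r; simp
    rw [Polynomial.map_mul, Polynomial.map_C, Polynomial.eval_mul, Polynomial.eval_C,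
      Polynomial.coe_evalRingHom, Polynomial.eval_pow, Polynomial.eval_X, Polynomial.map_map, hid,
      Polynomial.map_id, Polynomial.coe_evalRingHom]
  · rw [Polynomial.finsetSum_coeff, Polynomial.finsetSum_coeff]
    simp only [Polynomial.coeff_mul_C, Polynomial.coeff_map, Polynomial.coeff_C_mul_X_pow]
    rw [Finset.sum_ite_eq]
    split_ifs with hi
    · rfl
    · rw [Finset.mem_range, not_lt] at hi
      rw [Polynomial.coeff_eq_zero_of_natDegree_lt (p := F) (by omega), Polynomial.coeff_zero]

variable {F}

/-- **The transpose of an irreducible polynomial is irreducible.** [folklore] -/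
theorem irreducible_of_transposeRows (hFirr : Irreducible F) {Ft : ℂ[X][X]}
    (hFt : ∀ x y : ℂ, (Ft.map (Polynomial.evalRingHom x)).eval y = (F.map (Polynomial.evalRingHom y)).eval x) :
    Irreducible Ft := by
  classical
  obtain ⟨Φr, hΦr⟩ := exists_rowsEquiv
  have hirrA : Irreducible (Φr.symm F) := by
    refine (irreducible_rows_iff (Q := F) fun x y => ?_).2 hFirr
    rw [hΦr, RingEquiv.apply_symm_apply]
  set A' : MvPolynomial (Fin 2) ℂ := MvPolynomial.rename (Equiv.swap (0 : Fin 2) 1) (Φr.symm F) with hA'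
  have hirrA' : Irreducible A' :=
    (MulEquiv.irreducible_iff (MvPolynomial.renameEquiv ℂ (Equiv.swap (0 : Fin 2) 1)).toMulEquiv).2 hirrA
  refine (irreducible_rows_iff (P := A') (Q := Ft) fun x y => ?_).1 hirrA'
  rw [hA', MvPolynomial.eval_rename, hFt]
  have e : ((![x, y] : Fin 2 → ℂ) ∘ (Equiv.swap (0 : Fin 2) 1)) = ![y, x] := by
    funext i; fin_cases i <;> simp [Equiv.swap_apply_left, Equiv.swap_apply_right]
  rw [e, hΦr, RingEquiv.apply_symm_apply]

variable (F)

/-- **THE COMPLETE VERDICT OVER `ℚ̄`-CURVES WITH A HORIZONTAL ASYMPTOTE** (file CIV without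
transpose hypotheses).  `F ∈ ℚ̄[x₀][x₁]` irreducible of `x₁`-degree `≥ 2` whose top row has a
root: EVERY surface of Mantova–Masser's case with base curve `{F = 0}` has Zariski-dense
exponential points. [cite: MantovaMasser2023, §1 Further remarks, p. 5 (the question, open in
general)] (new) -/
theorem unprojectedDense_of_mmCase_topRowRoot_algebraic' (hFirr : Irreducible F)
    (halg : ∀ i j, IsAlgebraic ℚ ((F.coeff j).coeff i)) (hn : 2 ≤ F.natDegree)
    (N : ℕ) (hN : ∀ j, (F.coeff j).natDegree ≤ N) (T : ℂ[X])
    (hT : ∀ j, T.coeff j = (F.coeff j).coeff N) (hT0 : T ≠ 0) {θ : ℂ} (hTθ : T.IsRoot θ)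
    (F₃ : MvPolynomial (Fin 3) ℂ)
    (hF₃ : ∀ v : Fin 3 → ℂ, MvPolynomial.eval v F₃ = (F.map (Polynomial.evalRingHom (v 0))).eval (v 1))
    {W : Set (Fin 2 ⊕ Fin 2 → ℂ)} (hmm : MMCaseDimPiOneFree W)
    (hbase : MvPolynomial.zeroLocus ℂ (MvPolynomial.vanishingIdeal ℂ (projAdd '' (W ∩ torusLocus ℂ 2))) =
      {x : Fin 2 → ℂ | (F.map (Polynomial.evalRingHom (x 0))).eval (x 1) = 0}) :
    UnprojectedDense W := by
  obtain ⟨Ft, hFt, hcoeff⟩ := exists_transposeRows F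
  exact unprojectedDense_of_mmCase_topRowRoot_algebraic F hFirr hn N hN T hT hT0 hTθ Ft hFt
    (irreducible_of_transposeRows hFirr hFt) (fun i j => by rw [hcoeff]; exact halg j i) F₃ hF₃ hmm hbase

/-- The canonical `F₃` (`F` inside `ℂ[X₀, X₁, X₂]`) exists. [folklore] -/
theorem exists_curve₃ : ∃ F₃ : MvPolynomial (Fin 3) ℂ,
    ∀ v : Fin 3 → ℂ, MvPolynomial.eval v F₃ = (F.map (Polynomial.evalRingHom (v 0))).eval (v 1) := by
  classical
  obtain ⟨Φr, hΦr⟩ := exists_rowsEquiv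
  refine ⟨MvPolynomial.rename (Fin.castSucc : Fin 2 → Fin 3) (Φr.symm F), fun v => ?_⟩
  rw [MvPolynomial.eval_rename]
  have e : (v ∘ (Fin.castSucc : Fin 2 → Fin 3)) = ![v 0, v 1] := by
    funext i; fin_cases i <;> rfl
  rw [e, hΦr, RingEquiv.apply_symm_apply]

/-- **THE COMPLETE VERDICT, minimal hypotheses.**  `F ∈ ℚ̄[x₀][x₁]` irreducible of `x₁`-degree
`≥ 2` whose top row (at the maximal row degree) has a root: every surface of Mantova–Masser's
case with base curve `{F = 0}` has Zariski-dense exponential points.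
[cite: MantovaMasser2023, §1 Further remarks, p. 5 (the question, open in general)] (new) -/
theorem unprojectedDense_of_mmCase_horizontalAsymptote (hFirr : Irreducible F)
    (halg : ∀ i j, IsAlgebraic ℚ ((F.coeff j).coeff i)) (hn : 2 ≤ F.natDegree)
    (N : ℕ) (hN : ∀ j, (F.coeff j).natDegree ≤ N) (T : ℂ[X])
    (hT : ∀ j, T.coeff j = (F.coeff j).coeff N) (hT0 : T ≠ 0) {θ : ℂ} (hTθ : T.IsRoot θ)
    {W : Set (Fin 2 ⊕ Fin 2 → ℂ)} (hmm : MMCaseDimPiOneFree W)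
    (hbase : MvPolynomial.zeroLocus ℂ (MvPolynomial.vanishingIdeal ℂ (projAdd '' (W ∩ torusLocus ℂ 2))) =
      {x : Fin 2 → ℂ | (F.map (Polynomial.evalRingHom (x 0))).eval (x 1) = 0}) :
    UnprojectedDense W := by
  obtain ⟨F₃, hF₃⟩ := exists_curve₃ F
  exact unprojectedDense_of_mmCase_topRowRoot_algebraic' F hFirr halg hn N hN T hT hT0 hTθ F₃ hF₃ hmm hbase

end TransposeRows

end Summit.Schanuel.Schanuel.Theorems
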